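import Summits.CriticalPhenomena.PercolationContinuityZ3.Theses.PercBurnResprinkle
import Literature.Probability.Percolation.PercolationProofs
import Literature.Probability.Percolation.StaticRenormalizationBlocks
import Literature.Probability.Percolation.BondPercolationSymmetry
import Literature.Probability.Percolation.CriticalContinuityProofs
import Literature.Probability.LatticeModels.StarBoundary
import Summits.CriticalPhenomena.PercolationContinuityZ3.Theorems.PercBurnResprinkleVacantReignitionGoodBlockDensity
import Summits.CriticalPhenomena.PercolationContinuityZ3.Theorems.PercBurnResprinkleVacantReignitionGluing
import Summits.CriticalPhenomena.PercolationContinuityZ3.Theorems.PercBurnResprinkleVacantReignitionRooting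
import Summits.CriticalPhenomena.PercolationContinuityZ3.Theorems.PercBurnResprinkleVacantReignitionLevelShift
import Summits.CriticalPhenomena.PercolationContinuityZ3.Theorems.PercBurnResprinkleVacantReignitionBlockedPeierls
import Summits.CriticalPhenomena.PercolationContinuityZ3.Theorems.PercBurnResprinkleVacantReignitionDuality
import Summits.CriticalPhenomena.PercolationContinuityZ3.Theorems.PercBurnResprinkleVacantReignitionCoarseGlue
import Summits.CriticalPhenomena.PercolationContinuityZ3.Theorems.PercBurnResprinkleVacantReignitionCoarsePercolation
import Summits.CriticalPhenomena.PercolationContinuityZ3.Theorems.PercBurnResprinkleVacantReignitionBlockRooting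
import HarnessLib

/-!
# Crux `PercBurnResprinkle.VacantReignition` (stmt-CriticalPhenomena-7203), line `holes-are-fresh` — the line's
# theorem-grade output: RE-IGNITION REDUCED TO HARMLESSNESS OF THE CRITICAL ARM SHADOW (unconditionally)

Continuation lead prover-line-stmt-CriticalPhenomena-7203-c1-0, 2026-08-16.  Composes the nine LANDED stubs of the
reshaped line `Cruxes/VacantReignition/Lines/holes_are_fresh.lean` (ADKS separated architecture, arXiv:1302.6872 §2,
on the tree's (8.90) good blocks of Grimmett's static renormalisation) into ONE theorem:

* `vacantReignition_of_harmlessShadow` — the crux `VacantReignition` follows from the ENGINE `HarmlessShadow`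
  (the registered open stub `stub_harmlessShadow`, verbatim, def-free): for every aspect `k ≥ 1` and `η > 0` there
  are a coarse spacing `S ≥ k + 5` and a clump bound `D < S` such that for arbitrarily large block scales `L`, with
  `labelMeasure`-probability `≥ 1 - η`, every `★`-connected family of TOUCHED blocks `z ∈ ℤ²`, `|zᵢ| ≤ 3S`
  (touched: some vertex of the window `(2L+1)(0,z) + B(blockR L k)` has an `ω_{p_c}`-open arm to sup-distance
  `S(2L+1)`), has index-diameter `≤ D` — ONE random set (the block-resolution shadow of the CRITICAL arm set in a layer
  of blocks), ONE level `p_c`, no `ε`, no limit in `p`, scale-free.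

Ingredients (all landed, kernel-checked): `stub_goodBlockDensity` (p87632, density of good fresh blocks at every
`q ∈ (p_c, 1]`), `stub_levelShift` (p108126, the engine's bound moved from `p_c` to `p₁ > p_c` and to every coarse site),
`stub_blockedPeierls` (p107675, `P(Blocked) ≤ η` for small bad-block density), `stub_coarsePercolation` (p111945,
finitely dependent planar `★`-Peierls for the two-field coarse process), `stub_duality` (p107910, harmless ∧ not blocked
⇒ long-way rectangle crossings by vacant ∧ good blocks), `stub_coarseGlue` (p110855, infinite `★`-cluster of open coarse
sites ⇒ infinite block cluster), `stub_blockRooting` (p107770), `stub_gluing` (p87896), `stub_rooting` (p92097).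
Bookkeeping: `ε' = min ε (1 - p_c) > 0` (`criticalProb_zd_lt_one`), `q = p_c + ε' ∈ (p_c, 1]`; `k = k(q)`; `η₁`;
`(S, D)` from the engine at `(k, η₁/2)`; `δ(k, S, D, η₁)`; `L₀(q, δ)`; the engine at `max L₀ 1` gives `L`;
level shift gives the witness `p₁ > p_c`; `1/2 ≤ μ2(coarse percolation) ≤ μ2(some block of H(0) percolates)`; block
rooting, gluing, rooting; monotonicity of the vacant fresh configuration in the field level (`q ≤ p_c + ε`).
So the crux is CLOSED MODULO ITS ENGINE `HarmlessShadow` alone (open: continuity-strength, conceded — in a jump world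
the touched density tends to `1`; it is the scale-free "dust, not curves" statement for planar sections of macroscopic
critical clusters of `ℤ³`).  No new definitions.
-/

noncomputable section

namespace Summit.CriticalPhenomena.PercolationContinuityZ3.Theorems

open MeasureTheory Set
open Literature.Probability.Percolation Literature.Probability.LatticeModels

/-- **Re-ignition from harmlessness of the critical arm shadow** (line holes-are-fresh assembled):
`HarmlessShadow → VacantReignition`, unconditionally.  The hypothesis is the registered open stub
`stub_harmlessShadow` verbatim (def-free); the proof is the skeleton's composition `VacantReignition_of` with the nine
landed stubs. [cite: AhlbergEtAl2015, §2 (Thm 2 and its proof, separated architecture)] -/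
theorem vacantReignition_of_harmlessShadow :
    (∀ k : ℕ, 1 ≤ k → ∀ η : ℝ, 0 < η → ∃ S D : ℕ, k + 5 ≤ S ∧ D < S ∧ ∀ L₀ : ℕ, ∃ L : ℕ, L₀ ≤ L ∧
      (labelMeasure (Fin 3 → ℤ)).real {U : (Sym2 (Fin 3 → ℤ) → ℝ) |
        ¬ (∀ A : Finset (Fin 2 → ℤ), (∀ z ∈ A, (∀ i, |z i - (S : ℤ) * (0 : Fin 2 → ℤ) i| ≤ 3 * (S : ℤ)) ∧
        (∃ y ∈ (↑(box 3 (blockR L k)) : Set (Fin 3 → ℤ)),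
          BondConfig.relabel (sym2Equiv (Site.shift (-(((2 * L + 1 : ℕ) : ℤ) • (![0, z 0, z 1] : Fin 3 → ℤ))))) (configOfLabels (criticalProb (zdGraph 3) (0 : Fin 3 → ℤ)) U (zdGraph 3)) ∈ boxArm (S * (2 * L + 1)) y)) →
        StarConn (↑A : Set (Fin 2 → ℤ)) → (∀ z ∈ A, ∀ z' ∈ A, ∀ i, |z i - z' i| ≤ (D : ℤ)))} ≤ η) →
    Summit.CriticalPhenomena.PercolationContinuityZ3.Theses.PercBurnResprinkle.VacantReignition := by
  intro h1 ε hε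
  have hprob : IsProbabilityMeasure (labelMeasure (Fin 3 → ℤ)) := isProbabilityMeasure_labelMeasure _
  -- the supercritical fresh level `q = p_c + ε' ∈ (p_c, 1]`
  have hpc1 : criticalProb (zdGraph 3) (0 : Fin 3 → ℤ) < 1 := criticalProb_zd_lt_one (d := 3) (by norm_num)
  have hpc0 : 0 ≤ criticalProb (zdGraph 3) (0 : Fin 3 → ℤ) := (criticalProb_mem_Icc _ _).1
  set ε' : ℝ := min ε (1 - criticalProb (zdGraph 3) (0 : Fin 3 → ℤ)) with hε'
  have hε'pos : 0 < ε' := lt_min hε (by linarith)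
  have hε'le : ε' ≤ ε := min_le_left _ _
  have hq1 : criticalProb (zdGraph 3) (0 : Fin 3 → ℤ) + ε' ≤ 1 := by
    have := min_le_right ε (1 - criticalProb (zdGraph 3) (0 : Fin 3 → ℤ)); linarith
  set q : unitInterval := ⟨criticalProb (zdGraph 3) (0 : Fin 3 → ℤ) + ε', by linarith, hq1⟩ with hqdef
  have hq : criticalProb (zdGraph 3) (0 : Fin 3 → ℤ) < (q : ℝ) := by
    show criticalProb (zdGraph 3) (0 : Fin 3 → ℤ) < criticalProb (zdGraph 3) (0 : Fin 3 → ℤ) + ε'; linarith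
  -- constants: `k(q)`, `η₁`, `(S, D)` from the engine, `δ`, `L₀`, `L`, `p₁`
  obtain ⟨k, hk, hDk⟩ := stub_goodBlockDensity q hq
  obtain ⟨η₁, hη₁, h5⟩ := stub_coarsePercolation
  obtain ⟨S, D, hSk, hDS, hEng⟩ := h1 k hk (η₁ / 2) (by positivity)
  obtain ⟨δ, hδ, hBl⟩ := stub_blockedPeierls k hk S D hDS η₁ hη₁
  obtain ⟨L₀, hL₀⟩ := hDk δ hδ
  obtain ⟨L, hLL, hHarm⟩ := hEng (max L₀ 1)
  have hL1 : 1 ≤ L := le_trans (le_max_right _ _) hLL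
  have hL0 : L₀ ≤ L := le_trans (le_max_left _ _) hLL
  have hS3 : k + 3 ≤ S := by omega
  have hS1 : 1 ≤ S := by omega
  obtain ⟨p₁, hp₁, hshift⟩ := stub_levelShift k S D L (η₁ / 2) η₁ (by linarith) hHarm
  have hHx := hshift p₁ hp₁.le le_rfl
  have hBx := hBl L hL1 (q : ℝ) (hL₀ L hL0)
  -- coarse percolation with probability ≥ 1/2, duality + coarse gluing, block rooting
  have hhalf := h5 k hk S D L hSk hL1 p₁ (q : ℝ) hHx hBx
  have hroot := stub_blockRooting k S L p₁ (q : ℝ)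
    (lt_of_lt_of_le (by norm_num) (hhalf.trans (measureReal_mono ?incl)))
  case incl =>
    rintro π ⟨h0, hinf⟩
    refine stub_coarseGlue k S L hS1 p₁ (q : ℝ) π
      (stub_duality k S D L hS3 hDS hL1 p₁ (q : ℝ) 0 π h0.1 h0.2) ?_
    refine hinf.mono (fun x hx => ?_)
    exact reflTransGen_starRel_mono
      (fun x' hx' => stub_duality k S D L hS3 hDS hL1 p₁ (q : ℝ) x' π hx'.1 hx'.2) hx
  -- gluing into a vacant-fresh cluster near the origin, rooting, monotonicity in the field level
  have hnear := lt_of_lt_of_le hroot (measureReal_mono (fun π hπ => stub_gluing L hL1 k hk p₁ (q : ℝ) π hπ))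
  have hfin := stub_rooting L p₁ (q : ℝ) hnear
  have hqle : (q : ℝ) ≤ criticalProb (zdGraph 3) (0 : Fin 3 → ℤ) + ε := by
    show criticalProb (zdGraph 3) (0 : Fin 3 → ℤ) + ε' ≤ criticalProb (zdGraph 3) (0 : Fin 3 → ℤ) + ε; linarith
  refine ⟨p₁, hp₁, lt_of_lt_of_le hfin (measureReal_mono ?_)⟩
  intro π hπ
  refine Set.Infinite.mono (openCluster_mono (fun e he => ?_) 0) hπ
  exact ⟨configOfLabels_mono π.2 (zdGraph 3) hqle he.1, he.2⟩

end Summit.CriticalPhenomena.PercolationContinuityZ3.Theorems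

end
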